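import Mathlib
import Literature.Probability.Moments.HerbstArgument
import HarnessLib

/-!
# Exponential integrability from a Poincaré inequality (Gromov–Milman, Aida–Stroock)

Pure measure-theoretic probability; everything in this file is proved (no definitions, no
named facts).  Companion of `Literature.Probability.Moments.HerbstArgument` (entropy bound ⇒
sub-Gaussian tail): here the input is the weaker VARIANCE bound and the output the weaker
EXPONENTIAL tail.

Let `ν` be a probability measure, `ψ` a bounded measurable real function with mean
`m = ∫ ψ dν`, and `c ≥ 0`. Suppose that for every real `l`

  `Var_ν(e^{lψ/2}) = ∫ e^{lψ} dν − (∫ e^{lψ/2} dν)² ≤ c l² ∫ e^{lψ} dν`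

(this is what a Poincaré inequality `Var_ν(g) ≤ C_P ∫ |∇g|² dν` gives for `g = e^{lψ/2}` when
`|∇ψ| ≤ Λ`, with `c = C_P Λ²/4`). Then

* `log ∫ e^{lψ} dν ≤ l m + 2cl²/(1 − cl²)` whenever `cl² < 1` (`cgf_le_of_variance_le`): the
  Laplace transform is finite and sub-Gaussian NEAR THE ORIGIN only;
* `∫ e^{l(ψ − m)} dν ≤ exp (2cl²/(1 − cl²))` for `cl² < 1`
  (`integral_exp_mul_sub_integral_le_of_variance_le`);
* `ν {ψ − m ≥ r} ≤ e² · exp (−r/√(2c))` for every real `r` (and `c > 0`)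
  (`measure_ge_le_exp_of_variance_le`, Chernoff at `l = 1/√(2c)`): EXPONENTIAL concentration at
  the Poincaré scale `√C_P · Λ`.

This is the Gromov–Milman theorem (exponential concentration of Lipschitz functions under a
spectral gap) in the moment-generating-function form of Aida–Stroock and Bobkov–Ledoux, as in
Bakry–Gentil–Ledoux 2014, Prop. 4.4.2: the Poincaré inequality is consumed only through the
displayed variance inequality for the one-parameter family `e^{lψ/2}`, so no geometry (Dirichlet
form, Lipschitz structure) appears here.

## The argument

With `Z(l) = ∫ e^{lψ} dν = mgf ψ ν l > 0` and `Λ = log Z = cgf ψ ν`, the hypothesis at parameter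
`s` reads `Z(s)(1 − cs²) ≤ Z(s/2)²`, i.e. (for `cs² < 1`)
`Λ(s) ≤ 2Λ(s/2) − log(1 − cs²) ≤ 2Λ(s/2) + cs²/(1 − cs²)`
(`cgf_le_two_mul_cgf_half_add_of_variance_le`). Iterating `n` times along `s = l, l/2, l/4, …`
(where `c(l/2^k)² = cl²/4^k` and `1 − cl²/4^k ≥ 1 − cl²`) gives
`Λ(l) ≤ 2^n Λ(l/2^n) + (2 − 2^{1−n}) · cl²/(1 − cl²)` (`cgf_le_pow_mul_cgf_add_of_variance_le`),
and `2^n Λ(l/2^n) = l · Λ(s_n)/s_n → l · Λ'(0) = l m` as `s_n = l/2^n → 0` since `ψ` is bounded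
(`ProbabilityTheory.hasDerivAt_mgf`; `tendsto_pow_mul_cgf_div_pow`). The tail bound is Mathlib's
Chernoff bound `ProbabilityTheory.measure_ge_le_exp_mul_mgf`.

What is NOT here: Poincaré inequalities themselves, Lipschitz functions and `|∇ψ|`, spectral
gaps of generators; the hypothesis is the already-integrated variance inequality for the
one-parameter family `e^{lψ/2}`.

## References

* D. Bakry, I. Gentil, M. Ledoux, *Analysis and Geometry of Markov Diffusion Operators*,
  Grundlehren 348, Springer (2014), Prop. 4.4.2 (exponential integrability under a Poincaré
  inequality) and §4.4.2–4.4.3. [BakryGentilLedoux2014]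
* M. Gromov, V. D. Milman, *A topological application of the isoperimetric inequality*,
  Amer. J. Math. 105 (1983) 843–854 (Theorem 4.1: spectral gap ⇒ exponential concentration).
  [GromovMilman1983]
* S. Aida, D. Stroock, *Moment estimates derived from Poincaré and logarithmic Sobolev
  inequalities*, Math. Res. Lett. 1 (1994) 75–86 (the `l ↦ l/2` recursion). [AidaStroock1994]
* M. Ledoux, *The Concentration of Measure Phenomenon*, AMS Surveys 89 (2001), Thm. 3.1 /
  Cor. 3.2. [LedouxConcentration2001]
-/

namespace Literature.Probability.Moments

open _root_.MeasureTheory _root_.ProbabilityTheory _root_.Real _root_.Filter _root_.Set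
open scoped _root_.Topology

variable {α : Type*} [MeasurableSpace α]

section Poincare

variable (ν : Measure α) [IsProbabilityMeasure ν] {ψ : α → ℝ} {C c : ℝ}

/-- **One doubling step.** If `ψ` is bounded and measurable, `c ≥ 0`, and
`∫ e^{lψ} dν − (∫ e^{lψ/2} dν)² ≤ c l² ∫ e^{lψ} dν` for every real `l`, then for every `s` with
`cs² < 1` the cumulant generating function satisfies
`log ∫ e^{sψ} ≤ 2 log ∫ e^{sψ/2} + cs²/(1 − cs²)`.
[cite: BakryGentilLedoux2014, Prop. 4.4.2] -/
theorem cgf_le_two_mul_cgf_half_add_of_variance_le (hψ : Measurable ψ) (hC : ∀ y, |ψ y| ≤ C)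
    (hVar : ∀ l : ℝ, ∫ y, exp (l * ψ y) ∂ν - (∫ y, exp (l / 2 * ψ y) ∂ν) ^ 2 ≤
      c * l ^ 2 * ∫ y, exp (l * ψ y) ∂ν)
    {s : ℝ} (hs : c * s ^ 2 < 1) :
    cgf ψ ν s ≤ 2 * cgf ψ ν (s / 2) + c * s ^ 2 / (1 - c * s ^ 2) := by
  have hint : ∀ t : ℝ, Integrable (fun y => exp (t * ψ y)) ν :=
    integrable_exp_mul_of_abs_le_const ν hψ hC
  have hZ : ∀ t, 0 < mgf ψ ν t := fun t => mgf_pos (hint t)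
  have hpos : 0 < 1 - c * s ^ 2 := by linarith
  -- `Z(s)(1 - c s²) ≤ Z(s/2)²`
  have h1 : mgf ψ ν s * (1 - c * s ^ 2) ≤ mgf ψ ν (s / 2) ^ 2 := by
    have h : mgf ψ ν s - mgf ψ ν (s / 2) ^ 2 ≤ c * s ^ 2 * mgf ψ ν s := hVar s
    nlinarith [h]
  -- take logarithms
  have hlog : cgf ψ ν s + log (1 - c * s ^ 2) ≤ 2 * cgf ψ ν (s / 2) := by
    have h := Real.log_le_log (mul_pos (hZ s) hpos) h1
    rw [Real.log_mul (hZ s).ne' hpos.ne', Real.log_pow] at h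
    simpa [cgf] using h
  -- `-log(1-x) ≤ x/(1-x)`
  have hlog2 : -log (1 - c * s ^ 2) ≤ c * s ^ 2 / (1 - c * s ^ 2) := by
    have h := Real.one_sub_inv_le_log_of_pos hpos
    have h' : (1 - c * s ^ 2)⁻¹ - 1 = c * s ^ 2 / (1 - c * s ^ 2) := by
      field_simp
      ring
    linarith [h'.le, h'.ge]
  linarith

/-- **The doubling recursion, iterated.** Under the hypotheses of
`cgf_le_two_mul_cgf_half_add_of_variance_le`, for every `l` with `cl² < 1` and every `n`,
`log ∫ e^{lψ} ≤ 2^n log ∫ e^{lψ/2^n} + (2 − 2/2^n) · cl²/(1 − cl²)`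
(at step `k` the parameter is `l/2^k`, `c(l/2^k)² = cl²/4^k`, and `1 − cl²/4^k ≥ 1 − cl²`).
[cite: BakryGentilLedoux2014, Prop. 4.4.2] -/
theorem cgf_le_pow_mul_cgf_add_of_variance_le (hψ : Measurable ψ) (hC : ∀ y, |ψ y| ≤ C)
    (hc : 0 ≤ c)
    (hVar : ∀ l : ℝ, ∫ y, exp (l * ψ y) ∂ν - (∫ y, exp (l / 2 * ψ y) ∂ν) ^ 2 ≤
      c * l ^ 2 * ∫ y, exp (l * ψ y) ∂ν)
    {l : ℝ} (hl : c * l ^ 2 < 1) (n : ℕ) :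
    cgf ψ ν l ≤ 2 ^ n * cgf ψ ν (l / 2 ^ n) +
      (2 - 2 / 2 ^ n) * (c * l ^ 2 / (1 - c * l ^ 2)) := by
  induction n with
  | zero => simp
  | succ n ih =>
    have h2n : (0 : ℝ) < 2 ^ n := pow_pos two_pos n
    have hpos : 0 < 1 - c * l ^ 2 := by linarith
    -- the parameter at step `n`
    set s : ℝ := l / 2 ^ n with hs_def
    have hs2 : c * s ^ 2 = c * l ^ 2 / (2 ^ n) ^ 2 := by
      rw [hs_def, div_pow, mul_div_assoc]
    have hle1 : c * s ^ 2 ≤ c * l ^ 2 := by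
      rw [hs2]
      refine div_le_self (mul_nonneg hc (sq_nonneg l)) ?_
      have h1 : (1 : ℝ) ≤ 2 ^ n := one_le_pow₀ (by norm_num)
      exact one_le_pow₀ h1
    have hs1 : c * s ^ 2 < 1 := hle1.trans_lt hl
    have hstep := cgf_le_two_mul_cgf_half_add_of_variance_le ν hψ hC hVar hs1
    -- compare the error terms: `c s²/(1 - c s²) ≤ (c l²/(2^n)²)/(1 - c l²)`
    have herr : c * s ^ 2 / (1 - c * s ^ 2) ≤ c * l ^ 2 / (2 ^ n) ^ 2 / (1 - c * l ^ 2) := by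
      rw [hs2]
      exact div_le_div_of_nonneg_left (by positivity) hpos (by linarith)
    have hs' : s / 2 = l / 2 ^ (n + 1) := by
      rw [hs_def, pow_succ]; ring
    rw [hs'] at hstep
    -- multiply the one-step inequality by `2^n`
    have hmul : 2 ^ n * cgf ψ ν s ≤
        2 ^ (n + 1) * cgf ψ ν (l / 2 ^ (n + 1)) + c * l ^ 2 / 2 ^ n / (1 - c * l ^ 2) := by
      have h0 : cgf ψ ν s ≤
          2 * cgf ψ ν (l / 2 ^ (n + 1)) + c * l ^ 2 / (2 ^ n) ^ 2 / (1 - c * l ^ 2) := by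
        linarith [hstep, herr]
      have h := mul_le_mul_of_nonneg_left h0 h2n.le
      have hid : (2 : ℝ) ^ n * (c * l ^ 2 / (2 ^ n) ^ 2 / (1 - c * l ^ 2)) =
          c * l ^ 2 / 2 ^ n / (1 - c * l ^ 2) := by
        field_simp
      calc (2 : ℝ) ^ n * cgf ψ ν s
          ≤ 2 ^ n * (2 * cgf ψ ν (l / 2 ^ (n + 1)) + c * l ^ 2 / (2 ^ n) ^ 2 / (1 - c * l ^ 2)) := h
        _ = 2 ^ (n + 1) * cgf ψ ν (l / 2 ^ (n + 1)) + c * l ^ 2 / 2 ^ n / (1 - c * l ^ 2) := by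
          rw [mul_add, hid, pow_succ]; ring
    have hid2 : (2 - 2 / 2 ^ n) * (c * l ^ 2 / (1 - c * l ^ 2)) + c * l ^ 2 / 2 ^ n / (1 - c * l ^ 2) =
        (2 - 2 / 2 ^ (n + 1)) * (c * l ^ 2 / (1 - c * l ^ 2)) := by
      rw [pow_succ]
      field_simp
      ring
    calc cgf ψ ν l ≤ 2 ^ n * cgf ψ ν s + (2 - 2 / 2 ^ n) * (c * l ^ 2 / (1 - c * l ^ 2)) := ih
      _ ≤ 2 ^ (n + 1) * cgf ψ ν (l / 2 ^ (n + 1)) + c * l ^ 2 / 2 ^ n / (1 - c * l ^ 2) +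
            (2 - 2 / 2 ^ n) * (c * l ^ 2 / (1 - c * l ^ 2)) := by linarith
      _ = 2 ^ (n + 1) * cgf ψ ν (l / 2 ^ (n + 1)) +
            (2 - 2 / 2 ^ (n + 1)) * (c * l ^ 2 / (1 - c * l ^ 2)) := by
          rw [← hid2]; ring

/-- For a bounded measurable `ψ`, `2^n · log ∫ e^{(l/2^n)ψ} dν → l · ∫ ψ dν` as `n → ∞`
(the cumulant generating function is differentiable at `0` with derivative the mean,
`ProbabilityTheory.hasDerivAt_mgf`). [folklore] -/
private theorem tendsto_pow_mul_cgf_div_pow (hψ : Measurable ψ) (hC : ∀ y, |ψ y| ≤ C) (l : ℝ) :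
    Tendsto (fun n : ℕ => (2 : ℝ) ^ n * cgf ψ ν (l / 2 ^ n)) atTop (𝓝 (l * ∫ z, ψ z ∂ν)) := by
  have hint : ∀ t : ℝ, Integrable (fun y => exp (t * ψ y)) ν :=
    integrable_exp_mul_of_abs_le_const ν hψ hC
  have hmem : (0 : ℝ) ∈ interior (integrableExpSet ψ ν) := by
    rw [(eq_univ_of_forall hint : integrableExpSet ψ ν = univ), interior_univ]
    exact mem_univ 0
  have hZ0 : 0 < mgf ψ ν 0 := mgf_pos (hint 0)
  -- `cgf ψ ν` is differentiable at `0` with derivative the mean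
  have hΛd : HasDerivAt (cgf ψ ν) ((∫ y, ψ y * exp (0 * ψ y) ∂ν) / mgf ψ ν 0) 0 :=
    (hasDerivAt_mgf hmem).log hZ0.ne'
  have hm : (∫ y, ψ y * exp (0 * ψ y) ∂ν) / mgf ψ ν 0 = ∫ z, ψ z ∂ν := by simp
  rw [hm] at hΛd
  -- hence `cgf ψ ν s / s → ∫ ψ` as `s → 0`, `s ≠ 0`
  have htend : Tendsto (fun s => cgf ψ ν s / s) (𝓝[≠] 0) (𝓝 (∫ z, ψ z ∂ν)) := by
    have h := hΛd
    rw [hasDerivAt_iff_tendsto_slope_zero] at h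
    simp only [zero_add, cgf_zero, sub_zero, smul_eq_mul] at h
    refine h.congr fun s => ?_
    rw [inv_mul_eq_div]
  rcases eq_or_ne l 0 with rfl | hl
  · simp [cgf_zero]
  -- the sequence `s_n = l / 2^n` tends to `0` within `{0}ᶜ`
  have hseq : Tendsto (fun n : ℕ => l / (2 : ℝ) ^ n) atTop (𝓝[≠] 0) := by
    refine tendsto_nhdsWithin_iff.2 ⟨?_, Eventually.of_forall fun n => ?_⟩
    · have h := (tendsto_pow_atTop_nhds_zero_of_lt_one (by norm_num : (0 : ℝ) ≤ 1 / 2)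
        (by norm_num : (1 : ℝ) / 2 < 1)).const_mul l
      rw [mul_zero] at h
      refine h.congr fun n => ?_
      rw [one_div, inv_pow, div_eq_mul_inv]
    · exact div_ne_zero hl (pow_ne_zero n two_ne_zero)
  have h := (htend.comp hseq).const_mul l
  refine h.congr fun n => ?_
  have h2 : (2 : ℝ) ^ n ≠ 0 := pow_ne_zero n two_ne_zero
  simp only [Function.comp_def]
  field_simp

/-- **Exponential integrability under a Poincaré inequality, cumulant form** (Gromov–Milman,
Aida–Stroock; Bakry–Gentil–Ledoux Prop. 4.4.2). If `ψ` is bounded and measurable, `c ≥ 0`, and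
`∫ e^{lψ} dν − (∫ e^{lψ/2} dν)² ≤ c l² ∫ e^{lψ} dν` for every real `l`, then for every `l` with
`cl² < 1`: `log ∫ e^{lψ} dν ≤ l ∫ ψ dν + 2cl²/(1 − cl²)`.
[cite: BakryGentilLedoux2014, Prop. 4.4.2] -/
theorem cgf_le_of_variance_le (hψ : Measurable ψ) (hC : ∀ y, |ψ y| ≤ C) (hc : 0 ≤ c)
    (hVar : ∀ l : ℝ, ∫ y, exp (l * ψ y) ∂ν - (∫ y, exp (l / 2 * ψ y) ∂ν) ^ 2 ≤
      c * l ^ 2 * ∫ y, exp (l * ψ y) ∂ν)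
    {l : ℝ} (hl : c * l ^ 2 < 1) :
    cgf ψ ν l ≤ l * ∫ z, ψ z ∂ν + 2 * (c * l ^ 2 / (1 - c * l ^ 2)) := by
  have hD : 0 ≤ c * l ^ 2 / (1 - c * l ^ 2) :=
    div_nonneg (mul_nonneg hc (sq_nonneg l)) (by linarith)
  have hbound : ∀ n : ℕ, cgf ψ ν l - 2 * (c * l ^ 2 / (1 - c * l ^ 2)) ≤
      (2 : ℝ) ^ n * cgf ψ ν (l / 2 ^ n) := fun n => by
    have h := cgf_le_pow_mul_cgf_add_of_variance_le ν hψ hC hc hVar hl n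
    have h2 : (2 - 2 / (2 : ℝ) ^ n) * (c * l ^ 2 / (1 - c * l ^ 2)) ≤
        2 * (c * l ^ 2 / (1 - c * l ^ 2)) :=
      mul_le_mul_of_nonneg_right
        (by linarith [show (0 : ℝ) ≤ 2 / 2 ^ n from by positivity]) hD
    linarith
  have hlim := ge_of_tendsto' (tendsto_pow_mul_cgf_div_pow ν hψ hC l) hbound
  linarith

/-- **Laplace bound near the origin from a variance bound** (Poincaré ⇒ exponential
integrability): under the hypotheses of `cgf_le_of_variance_le`, for every `l` with `cl² < 1`,
`∫ exp (l (ψ − ∫ ψ dν)) dν ≤ exp (2cl²/(1 − cl²))`.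
[cite: BakryGentilLedoux2014, Prop. 4.4.2] -/
theorem integral_exp_mul_sub_integral_le_of_variance_le (hψ : Measurable ψ)
    (hC : ∀ y, |ψ y| ≤ C) (hc : 0 ≤ c)
    (hVar : ∀ l : ℝ, ∫ y, exp (l * ψ y) ∂ν - (∫ y, exp (l / 2 * ψ y) ∂ν) ^ 2 ≤
      c * l ^ 2 * ∫ y, exp (l * ψ y) ∂ν)
    {l : ℝ} (hl : c * l ^ 2 < 1) :
    ∫ y, exp (l * (ψ y - ∫ z, ψ z ∂ν)) ∂ν ≤ exp (2 * (c * l ^ 2 / (1 - c * l ^ 2))) := by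
  have h := cgf_le_of_variance_le ν hψ hC hc hVar hl
  have hint := integrable_exp_mul_of_abs_le_const ν hψ hC l
  calc ∫ y, exp (l * (ψ y - ∫ z, ψ z ∂ν)) ∂ν = exp (-(l * ∫ z, ψ z ∂ν)) * mgf ψ ν l := by
        rw [mgf, ← integral_const_mul]
        refine integral_congr_ae (ae_of_all _ fun y => ?_)
        show exp (l * (ψ y - ∫ z, ψ z ∂ν)) = exp (-(l * ∫ z, ψ z ∂ν)) * exp (l * ψ y)
        rw [← exp_add]
        congr 1
        ring
    _ = exp (-(l * ∫ z, ψ z ∂ν) + cgf ψ ν l) := by rw [exp_add, exp_cgf hint]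
    _ ≤ exp (2 * (c * l ^ 2 / (1 - c * l ^ 2))) := exp_le_exp.2 (by linarith)

/-- **Exponential concentration from a variance bound** (Gromov–Milman): under the hypotheses
of `cgf_le_of_variance_le` with `c > 0`, for every real `r`,
`ν {ψ − ∫ ψ dν ≥ r} ≤ e² · exp (−r/√(2c))` (Chernoff at `l = 1/√(2c)`, where `cl² = 1/2` and
the Laplace bound is `e²`). With `c = C_P Λ²/4` this is the exponential tail
`e² · exp (−√2 · r/(√C_P · Λ))` at the Poincaré scale.
[cite: BakryGentilLedoux2014, Prop. 4.4.2] -/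
theorem measure_ge_le_exp_of_variance_le (hψ : Measurable ψ) (hC : ∀ y, |ψ y| ≤ C)
    (hc : 0 < c)
    (hVar : ∀ l : ℝ, ∫ y, exp (l * ψ y) ∂ν - (∫ y, exp (l / 2 * ψ y) ∂ν) ^ 2 ≤
      c * l ^ 2 * ∫ y, exp (l * ψ y) ∂ν)
    (r : ℝ) :
    ν.real {y | r ≤ ψ y - ∫ z, ψ z ∂ν} ≤ exp 2 * exp (-(r / Real.sqrt (2 * c))) := by
  set l : ℝ := (Real.sqrt (2 * c))⁻¹ with hl_def
  have h2c : 0 < Real.sqrt (2 * c) := Real.sqrt_pos.2 (by linarith)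
  have hl0 : 0 ≤ l := by positivity
  have hcl : c * l ^ 2 = 1 / 2 := by
    rw [hl_def, inv_pow, Real.sq_sqrt (by linarith)]
    field_simp
  have hcl1 : c * l ^ 2 < 1 := by rw [hcl]; norm_num
  -- integrability of the centred exponential
  have hintc : Integrable (fun y => exp (l * (ψ y - ∫ z, ψ z ∂ν))) ν := by
    refine integrable_exp_mul_of_abs_le_const ν (hψ.sub_const _) (C := C + |∫ z, ψ z ∂ν|)
      (fun y => ?_) l
    exact (abs_sub _ _).trans (by linarith [hC y])
  have hchern := measure_ge_le_exp_mul_mgf (μ := ν) (X := fun y => ψ y - ∫ z, ψ z ∂ν) r hl0 hintc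
  have hmgf : mgf (fun y => ψ y - ∫ z, ψ z ∂ν) ν l ≤ exp 2 := by
    have h := integral_exp_mul_sub_integral_le_of_variance_le ν hψ hC hc.le hVar hcl1
    have h2 : (2 : ℝ) * (1 / 2 / (1 - 1 / 2)) = 2 := by norm_num
    rw [hcl, h2] at h
    exact h
  calc ν.real {y | r ≤ ψ y - ∫ z, ψ z ∂ν}
      ≤ exp (-l * r) * mgf (fun y => ψ y - ∫ z, ψ z ∂ν) ν l := hchern
    _ ≤ exp (-l * r) * exp 2 := mul_le_mul_of_nonneg_left hmgf (exp_pos _).le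
    _ = exp 2 * exp (-(r / Real.sqrt (2 * c))) := by
        rw [mul_comm, hl_def, neg_mul, div_eq_mul_inv, mul_comm r]

end Poincare

/-- **Exponential integrability and exponential concentration under a Poincaré inequality**
(Gromov–Milman 1983; Aida–Stroock 1994; Bakry–Gentil–Ledoux 2014, Prop. 4.4.2). Let `ν` be a
probability measure, `ψ` bounded measurable with mean `m = ∫ ψ dν`, and `c > 0` such that for
every real `l`: `∫ e^{lψ} dν − (∫ e^{lψ/2} dν)² ≤ c l² ∫ e^{lψ} dν` (the Poincaré inequality for
`e^{lψ/2}`). Then `∫ e^{l(ψ − m)} dν ≤ exp (2cl²/(1 − cl²))` for every `l` with `cl² < 1`, and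
`ν {ψ − m ≥ r} ≤ e² · exp (−r/√(2c))` for every real `r`.
[cite: BakryGentilLedoux2014, Prop. 4.4.2] -/
theorem poincare_laplace_and_tail_bound (ν : Measure α) [IsProbabilityMeasure ν] {ψ : α → ℝ}
    (hψ : Measurable ψ) (hbdd : ∃ C : ℝ, ∀ y, |ψ y| ≤ C) {c : ℝ} (hc : 0 < c)
    (hVar : ∀ l : ℝ, ∫ y, Real.exp (l * ψ y) ∂ν - (∫ y, Real.exp (l / 2 * ψ y) ∂ν) ^ 2 ≤
      c * l ^ 2 * ∫ y, Real.exp (l * ψ y) ∂ν) :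
    (∀ l : ℝ, c * l ^ 2 < 1 →
      ∫ y, Real.exp (l * (ψ y - ∫ z, ψ z ∂ν)) ∂ν ≤ Real.exp (2 * (c * l ^ 2 / (1 - c * l ^ 2)))) ∧
    (∀ r : ℝ,
      ν.real {y | r ≤ ψ y - ∫ z, ψ z ∂ν} ≤ Real.exp 2 * Real.exp (-(r / Real.sqrt (2 * c)))) := by
  obtain ⟨C, hC⟩ := hbdd
  exact ⟨fun l hl => integral_exp_mul_sub_integral_le_of_variance_le ν hψ hC hc.le hVar hl,
    fun r => measure_ge_le_exp_of_variance_le ν hψ hC hc hVar r⟩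

section Hierarchy

/-! ## The hierarchy of integrated faces: a sub-Gaussian Laplace bound (hence an entropy bound)
implies the variance bound -/

variable (ν : Measure α) [IsProbabilityMeasure ν] {ψ : α → ℝ} {C c : ℝ}

/-- `exp x · (1 − x) ≤ 1` for every real `x` (from `1 − x ≤ exp (−x)`). [folklore] -/
private theorem exp_mul_one_sub_le_one (x : ℝ) : exp x * (1 - x) ≤ 1 := by
  have h := add_one_le_exp (-x)
  have hx : exp x * exp (-x) = 1 := by rw [← exp_add, add_neg_cancel, exp_zero]
  nlinarith [exp_pos x, h]

/-- **A sub-Gaussian Laplace bound implies the variance bound** — the log-Sobolev ∕ Herbst face of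
concentration sits ABOVE the Poincaré face at the level of the integrated one-parameter families:
if `ψ` is bounded and measurable and `∫ e^{l(ψ − m)} dν ≤ exp (c l²)` for every real `l`
(`m = ∫ ψ dν`, `c` real), then `∫ e^{lψ} dν − (∫ e^{lψ/2} dν)² ≤ c l² ∫ e^{lψ} dν` for every real `l` — the
hypothesis `hVar` of `cgf_le_of_variance_le`, with the SAME constant `c`.  Proof: Jensen gives
`∫ e^{lψ/2} ≥ e^{lm/2}`, so the left side is `≤ e^{lm}(M − 1)` with `M = ∫ e^{l(ψ−m)} ≤ e^{cl²}`,
and `M(1 − cl²) ≤ e^{cl²}(1 − cl²) ≤ 1` (trivially if `cl² ≥ 1`).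
[cite: BakryGentilLedoux2014, Prop. 5.4.1 and Prop. 4.4.2] -/
theorem variance_le_of_laplace_le (hψ : Measurable ψ) (hC : ∀ y, |ψ y| ≤ C)
    (hL : ∀ l : ℝ, ∫ y, exp (l * (ψ y - ∫ z, ψ z ∂ν)) ∂ν ≤ exp (c * l ^ 2)) (l : ℝ) :
    ∫ y, exp (l * ψ y) ∂ν - (∫ y, exp (l / 2 * ψ y) ∂ν) ^ 2 ≤
      c * l ^ 2 * ∫ y, exp (l * ψ y) ∂ν := by
  set m : ℝ := ∫ z, ψ z ∂ν with hm
  have hint : ∀ t : ℝ, Integrable (fun y => exp (t * ψ y)) ν :=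
    integrable_exp_mul_of_abs_le_const ν hψ hC
  have hψi : Integrable ψ ν :=
    (integrable_const C).mono' hψ.aestronglyMeasurable
      (ae_of_all _ fun y => by rw [Real.norm_eq_abs]; exact hC y)
  set M : ℝ := ∫ y, exp (l * (ψ y - m)) ∂ν with hM
  have hM0 : 0 ≤ M := integral_nonneg fun y => (exp_pos _).le
  -- `∫ e^{lψ} = e^{lm} · M`
  have hsplit : ∫ y, exp (l * ψ y) ∂ν = exp (l * m) * M := by
    rw [hM, ← integral_const_mul]
    refine integral_congr_ae (ae_of_all _ fun y => ?_)
    show exp (l * ψ y) = exp (l * m) * exp (l * (ψ y - m))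
    rw [← exp_add]
    congr 1
    ring
  -- Jensen: `e^{(l/2) m} ≤ ∫ e^{(l/2)ψ}`
  have hJ : exp (l / 2 * m) ≤ ∫ y, exp (l / 2 * ψ y) ∂ν := by
    have h := (convexOn_exp).map_integral_le (μ := ν) (f := fun y => l / 2 * ψ y)
      continuous_exp.continuousOn isClosed_univ (ae_of_all _ fun y => Set.mem_univ _)
      (hψi.const_mul _) (hint (l / 2))
    rw [integral_const_mul] at h
    exact h
  have hJ2 : exp (l * m) ≤ (∫ y, exp (l / 2 * ψ y) ∂ν) ^ 2 := by
    have e : exp (l * m) = exp (l / 2 * m) ^ 2 := by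
      rw [sq, ← exp_add]
      congr 1
      ring
    rw [e]
    exact pow_le_pow_left₀ (exp_pos _).le hJ 2
  -- key: `M (1 - c l²) ≤ 1`
  have hkey : M * (1 - c * l ^ 2) ≤ 1 := by
    rcases le_or_gt 1 (c * l ^ 2) with h1 | h1
    · nlinarith [hM0]
    · calc M * (1 - c * l ^ 2) ≤ exp (c * l ^ 2) * (1 - c * l ^ 2) :=
            mul_le_mul_of_nonneg_right (hL l) (by linarith)
        _ ≤ 1 := exp_mul_one_sub_le_one _
  -- assemble
  rw [hsplit]
  have hE : 0 < exp (l * m) := exp_pos _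
  have h3 : exp (l * m) * (M * (1 - c * l ^ 2)) ≤ exp (l * m) * 1 :=
    mul_le_mul_of_nonneg_left hkey hE.le
  nlinarith [h3, hJ2, hM0, hE.le]

/-- **The entropy bound implies the variance bound** (LSI face ⟹ Poincaré face, integrated forms):
under the hypothesis of `herbst_laplace_and_tail_bound` — `ψ` bounded measurable, `c > 0`,
`Ent_ν(e^{lψ}) ≤ c l² ∫ e^{lψ} dν` for every real `l` — one has the hypothesis of
`poincare_laplace_and_tail_bound` with the same constant:
`∫ e^{lψ} dν − (∫ e^{lψ/2} dν)² ≤ c l² ∫ e^{lψ} dν` for every real `l`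
(Herbst's sub-Gaussian Laplace bound `integral_exp_mul_sub_integral_le_of_entropy_le`, then
`variance_le_of_laplace_le`). [cite: BakryGentilLedoux2014, Prop. 5.4.1 and Prop. 4.4.2] -/
theorem variance_le_of_entropy_le (hψ : Measurable ψ) (hC : ∀ y, |ψ y| ≤ C) (hc : 0 < c)
    (hEnt : ∀ l : ℝ, ∫ y, exp (l * ψ y) * (l * ψ y) ∂ν -
      (∫ y, exp (l * ψ y) ∂ν) * log (∫ y, exp (l * ψ y) ∂ν) ≤
        c * l ^ 2 * ∫ y, exp (l * ψ y) ∂ν)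
    (l : ℝ) :
    ∫ y, exp (l * ψ y) ∂ν - (∫ y, exp (l / 2 * ψ y) ∂ν) ^ 2 ≤
      c * l ^ 2 * ∫ y, exp (l * ψ y) ∂ν :=
  variance_le_of_laplace_le ν hψ hC
    (fun l' => integral_exp_mul_sub_integral_le_of_entropy_le ν hψ hC hc hEnt l') l

end Hierarchy

end Literature.Probability.Moments
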